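import Summits.ResolutionOfSingularities.ResolutionOfSingularities.Theorems.FrobeniusClosingSteerW9WitnessConcl
import HarnessLib

/-!
# Crux `Steer` (stmt-ResolutionOfSingularities-16345) — E-ROW row 7: the W10⁺ and W8⁺ FIBRE-WIDE `Concl` CERTIFICATES
# (res-L0-w41-plan-1 RULING 257 (a)(1); sibling of `…SteerW9WitnessConcl`, which is at the 400-line cap)

OURS (campaign res-hironaka, rung L ★L-G4, slot W4.1; res-D-brk-2 g6). Candidates, not facts; NOT a statement of H. Hironaka's
manuscript [claim: Hironaka2017, status: under-review]; AI formalisation, weaker than expert review;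
`--supports stmt-ResolutionOfSingularities-16345 --as helper`, counted 0. Definition-free. Radicands VERBATIM from RULING 257 (a)(1) (E-ROW
row 7, res-L0-w41-tri-1 TRIAGE v6.36 SHR-2 / strat-1 §2; `k = 𝔽₂`, here: any `k ⊆ K` of characteristic `2`):
* W10⁺: `t² = x⁵ + x⁴y¹⁴z + u³²·zu(z⁴ + z³u + u⁴)²` — in characteristic 2 this is `x⁵ + x⁴y¹⁴z + z⁹u³³ + z⁷u³⁵ + zu⁴¹`, pin `x⁴y¹⁴z`;
* W8⁺: `t² = x³ + x²y¹²z + u¹⁶·zu(z³ + zu² + u³)²` — in characteristic 2 this is `x³ + x²y¹²z + z⁷u¹⁷ + z³u²¹ + zu²³`, pin `x²y¹²z`.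
For every valuation ring `O ⊇ k` with `x, y, z, u ∈ O ∖ 0`, `k(x,y,z,u,t) = K`, `trdeg_k K = 4` and the pin the UNIQUE ν-minimal monomial
(the other four have strictly smaller `O.valuation`), `Concl O k[x,y,z,u] t` — one-line instances of
`SteerToricVertexExit.concl_of_dominant_monomial` (dominant vertex, `z`-exponent `1`). Characteristic 2 is used ONLY to expand the
printed squares. Scope: the `Concl` clause only. [cite: Teissier2014] [folklore]
-/

noncomputable section

-- single-problem summit: the doubled namespace component `ResolutionOfSingularities` is forced
set_option linter.dupNamespace false

open scoped BigOperators

namespace Summit.ResolutionOfSingularities.ResolutionOfSingularities.Theorems.SteerW9Witness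

open Summit.ResolutionOfSingularities.ResolutionOfSingularities.Theorems.SteerToricVertexExit

variable {k K : Type} [Field k] [Field K] [Algebra k K]

/-- **W10⁺ fibre-wide `Concl` witness** (E-ROW row 7): in characteristic `2`, `t² = x⁵ + x⁴y¹⁴z + u³²·zu(z⁴ + z³u + u⁴)²` with the pin
`x⁴y¹⁴z` the unique ν-minimal monomial among `x⁴y¹⁴z, x⁵, z⁹u³³, z⁷u³⁵, zu⁴¹` ⟹ `Concl O k[x,y,z,u] t`. OURS. [folklore] -/
theorem concl_W10plus_fibre [CharP K 2] (O : ValuationSubring K) (hk : ∀ c : k, algebraMap k K c ∈ O) (x y z u t : K)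
    (hxO : x ∈ O) (hyO : y ∈ O) (hzO : z ∈ O) (huO : u ∈ O) (hx : x ≠ 0) (hy : y ≠ 0) (hz : z ≠ 0) (hu : u ≠ 0)
    (ht : t ^ 2 = x ^ 5 + x ^ 4 * y ^ 14 * z + u ^ 32 * (z * u * (z ^ 4 + z ^ 3 * u + u ^ 4) ^ 2))
    (hgen : IntermediateField.adjoin k ({x, y, z, u, t} : Set K) = ⊤) (htr : Algebra.trdeg k K = 4)
    (h1 : O.valuation (x ^ 5) < O.valuation (x ^ 4 * y ^ 14 * z))
    (h2 : O.valuation (z ^ 9 * u ^ 33) < O.valuation (x ^ 4 * y ^ 14 * z))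
    (h3 : O.valuation (z ^ 7 * u ^ 35) < O.valuation (x ^ 4 * y ^ 14 * z))
    (h4 : O.valuation (z * u ^ 41) < O.valuation (x ^ 4 * y ^ 14 * z)) :
    SwitchingDichotomy.Words.Concl O (Algebra.adjoin k ({x, y, z, u} : Set K)) t := by
  classical
  have htwo : (2 : K) = 0 := by exact_mod_cast CharP.cast_eq_zero K 2
  have ht2 : t ^ 2 = x ^ 5 + x ^ 4 * y ^ 14 * z + z ^ 9 * u ^ 33 + z ^ 7 * u ^ 35 + z * u ^ 41 := by
    rw [ht]
    have e : u ^ 32 * (z * u * (z ^ 4 + z ^ 3 * u + u ^ 4) ^ 2) =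
        z ^ 9 * u ^ 33 + z ^ 7 * u ^ 35 + z * u ^ 41 + 2 * (z ^ 8 * u ^ 34 + z ^ 5 * u ^ 37 + z ^ 4 * u ^ 38) := by ring
    rw [e, htwo, zero_mul, add_zero]; ring
  let E : Fin 5 → Fin 4 → ℕ := ![![4, 14, 1, 0], ![5, 0, 0, 0], ![0, 0, 9, 33], ![0, 0, 7, 35], ![0, 0, 1, 41]]
  have hE : ∀ i, (∏ j, ![x, y, z, u] j ^ E i j) = ![x ^ 4 * y ^ 14 * z, x ^ 5, z ^ 9 * u ^ 33, z ^ 7 * u ^ 35, z * u ^ 41] i := by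
    intro i
    fin_cases i <;> simp [E, Fin.prod_univ_four]
  have ht' : t ^ 2 = ∑ i, algebraMap k K ((fun _ => (1 : k)) i) * ∏ j, ![x, y, z, u] j ^ E i j := by
    simp only [hE, map_one, one_mul, Fin.sum_univ_five]
    simp only [Matrix.cons_val_zero, Matrix.cons_val_one, Matrix.cons_val_two, Matrix.cons_val_three, Matrix.cons_val_four,
      Matrix.head_cons, Matrix.tail_cons]
    rw [ht2]; ring
  have hdom : ∀ i, i ≠ 0 → O.valuation (∏ j, ![x, y, z, u] j ^ E i j) < O.valuation (∏ j, ![x, y, z, u] j ^ E 0 j) := by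
    intro i hi
    rw [hE, hE]
    fin_cases i
    · exact absurd rfl hi
    · simpa using h1
    · simpa using h2
    · simpa using h3
    · simpa using h4
  have h := concl_of_dominant_monomial O hk ![x, y, z, u] (vec4_ne_zero hx hy hz hu) (vec4_mem O hxO hyO hzO huO) t
    (fun _ => (1 : k)) one_ne_zero E ⟨2, by simp [E]⟩ ht' hdom (adjoin_insert_range_vec4 x y z u t hgen) htr
  rwa [range_vec4] at h

/-- **W8⁺ fibre-wide `Concl` witness** (E-ROW row 7): in characteristic `2`, `t² = x³ + x²y¹²z + u¹⁶·zu(z³ + zu² + u³)²` with the pin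
`x²y¹²z` the unique ν-minimal monomial among `x²y¹²z, x³, z⁷u¹⁷, z³u²¹, zu²³` ⟹ `Concl O k[x,y,z,u] t`. OURS. [folklore] -/
theorem concl_W8plus_fibre [CharP K 2] (O : ValuationSubring K) (hk : ∀ c : k, algebraMap k K c ∈ O) (x y z u t : K)
    (hxO : x ∈ O) (hyO : y ∈ O) (hzO : z ∈ O) (huO : u ∈ O) (hx : x ≠ 0) (hy : y ≠ 0) (hz : z ≠ 0) (hu : u ≠ 0)
    (ht : t ^ 2 = x ^ 3 + x ^ 2 * y ^ 12 * z + u ^ 16 * (z * u * (z ^ 3 + z * u ^ 2 + u ^ 3) ^ 2))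
    (hgen : IntermediateField.adjoin k ({x, y, z, u, t} : Set K) = ⊤) (htr : Algebra.trdeg k K = 4)
    (h1 : O.valuation (x ^ 3) < O.valuation (x ^ 2 * y ^ 12 * z))
    (h2 : O.valuation (z ^ 7 * u ^ 17) < O.valuation (x ^ 2 * y ^ 12 * z))
    (h3 : O.valuation (z ^ 3 * u ^ 21) < O.valuation (x ^ 2 * y ^ 12 * z))
    (h4 : O.valuation (z * u ^ 23) < O.valuation (x ^ 2 * y ^ 12 * z)) :
    SwitchingDichotomy.Words.Concl O (Algebra.adjoin k ({x, y, z, u} : Set K)) t := by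
  classical
  have htwo : (2 : K) = 0 := by exact_mod_cast CharP.cast_eq_zero K 2
  have ht2 : t ^ 2 = x ^ 3 + x ^ 2 * y ^ 12 * z + z ^ 7 * u ^ 17 + z ^ 3 * u ^ 21 + z * u ^ 23 := by
    rw [ht]
    have e : u ^ 16 * (z * u * (z ^ 3 + z * u ^ 2 + u ^ 3) ^ 2) =
        z ^ 7 * u ^ 17 + z ^ 3 * u ^ 21 + z * u ^ 23 + 2 * (z ^ 5 * u ^ 19 + z ^ 4 * u ^ 20 + z ^ 2 * u ^ 22) := by ring
    rw [e, htwo, zero_mul, add_zero]; ring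
  let E : Fin 5 → Fin 4 → ℕ := ![![2, 12, 1, 0], ![3, 0, 0, 0], ![0, 0, 7, 17], ![0, 0, 3, 21], ![0, 0, 1, 23]]
  have hE : ∀ i, (∏ j, ![x, y, z, u] j ^ E i j) = ![x ^ 2 * y ^ 12 * z, x ^ 3, z ^ 7 * u ^ 17, z ^ 3 * u ^ 21, z * u ^ 23] i := by
    intro i
    fin_cases i <;> simp [E, Fin.prod_univ_four]
  have ht' : t ^ 2 = ∑ i, algebraMap k K ((fun _ => (1 : k)) i) * ∏ j, ![x, y, z, u] j ^ E i j := by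
    simp only [hE, map_one, one_mul, Fin.sum_univ_five]
    simp only [Matrix.cons_val_zero, Matrix.cons_val_one, Matrix.cons_val_two, Matrix.cons_val_three, Matrix.cons_val_four,
      Matrix.head_cons, Matrix.tail_cons]
    rw [ht2]; ring
  have hdom : ∀ i, i ≠ 0 → O.valuation (∏ j, ![x, y, z, u] j ^ E i j) < O.valuation (∏ j, ![x, y, z, u] j ^ E 0 j) := by
    intro i hi
    rw [hE, hE]
    fin_cases i
    · exact absurd rfl hi
    · simpa using h1
    · simpa using h2
    · simpa using h3
    · simpa using h4
  have h := concl_of_dominant_monomial O hk ![x, y, z, u] (vec4_ne_zero hx hy hz hu) (vec4_mem O hxO hyO hzO huO) t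
    (fun _ => (1 : k)) one_ne_zero E ⟨2, by simp [E]⟩ ht' hdom (adjoin_insert_range_vec4 x y z u t hgen) htr
  rwa [range_vec4] at h

end Summit.ResolutionOfSingularities.ResolutionOfSingularities.Theorems.SteerW9Witness

end
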